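/-
Copyright (c) 2026 the pub-hodgecm-mathlib formalisation cell (harness21).  Prover seat hodgecm-mathlib-K2E3-p11 (g7), Track B «K2-LIT» ∕ h413
(`stmt-HodgeConjecture-24833`), line `K2_E3_EllipticInputs`, road (11-3-split-nsc), leaf (nsc-S-A′) `sig_K2E3GL3PrincipalBlockStandardSpan` (architect K2E3-p25 (g2),
`MEMO-SA-architecture.v2` §1), dealer K2E3-plan (g4) D88, brick GL2-UNL: «UNLINKED ⇒ IRREDUCIBLE» FOR THE PRINCIPAL SERIES `x × y` OF `GL₂(F)`.  2026-09-04.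
-/
import Summits.HodgeConjecture.HodgeConjecture.Theorems.K2E3GL2JacquetExponents                    -- ★ G1 (K2E3-p03): exponents of `x × y`, `exists_jacquetLinearMap`, `finrank_weightSpace_le_of_injective`; brings ★ E1a∕E1b
import Summits.HodgeConjecture.HodgeConjecture.Theorems.K2E3GL2ReducibleInducedDetCharConstituent   -- ★ G2 (K2E3-p03): a reducible `x × y` has a constituent `η ∘ det`; brings ★ `IrrClass.IsConstituentOf`, ★ `SmoothIrrep.ofChar`
import Summits.HodgeConjecture.HodgeConjecture.Theorems.K2E3LocalFieldAddCharExists                  -- ★ PSI-EX (K2E3-p24): `exists_addChar_isContinuousNontrivial`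
import Literature.NumberTheory.Automorphic.GLnMaximalParabolicLocalModulus                            -- ★ `rootDeltaChar_standardParabolicGL_lastBlockLabel_rpow` (`δ_Q^{1∕2}` of `Q_{1,1}`)
import Literature.NumberTheory.Automorphic.Zelevinsky1980.DetCharInducingDatum                        -- ★ `det_leviProjection_diagGL`, `maxParabolicLeviChar_leviProjection_diag_zero∕_last`
import Literature.NumberTheory.Automorphic.Zelevinsky1980.RankTwoDetCharSelfIrreducible               -- ★ `coe_det_leviProjection_lastBlockLabel_two_false∕_true`
import Literature.NumberTheory.Automorphic.TateLocalFactors                                           -- ★ `unramifiedTwist` (`ν = ‖·‖`), `unramifiedTwist_apply`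
import HarnessLib

/-!
# K2_E3 road (h413), leaf (nsc-S-A′), brick GL2-UNL: for characters `x, y` of `F^×` which are NOT LINKED (`y ≠ x ν` and `x ≠ y ν`, `ν = ‖·‖`) the
# principal series `x × y = i_{Q_{1,1}}(x ⊠ y)` of `GL₂(F)` is irreducible; in particular `x × x` is irreducible for EVERY continuous `x`

Cell `pub/hodgecm-mathlib` (D-0151), Track B, seat K2E3-p11 (g7); architect K2E3-p25 (g2) (`MEMO-SA-architecture.v2` §1 row GL2-UNL; consumers: H0 `K2E3GL3ExponentRules`
(hypotheses `(I₂ (xν½) (yν½)).IsIrreducible`), C0-IRR, rules (s₁)(s₂)(par)), dealer K2E3-plan (g4) D88.  `--supports stmt-HodgeConjecture-24833 --as helper`; THEOREMS ONLY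
(no definition ∕ instance ∕ notation ∕ named fact ∕ `sorry`); never imports `Cruxes/…/Lines`.  COUNT-NEUTRAL helper.

NOTATION (spelled out inline; ★ G1 currency).  `F` a non-archimedean local field; `Q = standardParabolicGL F (lastBlockLabel 2)` (the Borel of `GL₂`), `LB₂ = Π a : Bool, GL {i // …} F`
its Levi `GL₁ × GL₁`; `x ⊠ y = maxParabolicLeviChar F 2 x y`; `I₂ x y = parabolicIndGL F (lastBlockLabel 2) (𝟙.twist (x ⊠ y))` (`= x × y`, normalised);
`mult₂ V χ = finrank ℂ ↥(⨅ m, maxGenEigenspace (normalizedJacquetGL F (lastBlockLabel 2) V m) (χ m))` for `χ : LB₂ →* ℂˣ`; `ν = (unramifiedTwist F 1).toMonoidHom`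
(`ν t = ‖t‖`); for `η : F^× →* ℂ^×`: `ρ_η = (trivial ℂ (GL (Fin 2) F) ℂ).twist (η ∘ det)` and its NORMALISED JACQUET EXPONENT written intrinsically
`χ_η := (η ⊠ η) · (δ_Q^{1∕2} ∘ diag)⁻¹ : LB₂ →* ℂˣ` (which is `(η ν^{-1∕2}) ⊠ (η ν^{1∕2})`; no half-powers enter the statements).  «`x, y` LINKED» means `y = x ν` or `x = y ν`.

THE MATHEMATICS [JacquetLanglands1970, Thm. 3.3]; [BernsteinZelevinsky1977, Thm. 5.2, 2.12]; [Zelevinsky1980, §1.1, Ex. 3.2, Thm. 4.2]; [Bump1997, Thm. 4.5.1–4.5.4]; [BushnellHenniart2006, §9.6, §9.11].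
* §1 the one-dimensional `ρ_η = η ∘ det` of `GL₂(F)`: `U_Q` acts trivially, `r_Q ρ_η = ℂ`, the normalised action of `m ∈ LB₂` is the scalar `χ_η(m)` (★ `normalizedJacquetGL_mk`), so
  `mult₂ ρ_η χ = [χ = χ_η]` (★ E1b).
* §2 **A CONSTITUENT'S EXPONENT OCCURS**: if `⟦η ∘ det⟧` is a constituent of `I₂ x y` (`N₂ ≤ N₁ ≤ I₂ x y`, `N₁ ⁄ N₂ ≅ η ∘ det`, ★ `IrrClass.IsConstituentOf`), then
  `mult₂ (I₂ x y) χ_η ≥ mult₂ N₁ χ_η ≥ mult₂ (N₁⁄N₂) χ_η = mult₂ ρ_η χ_η = 1` (★ G1 `exists_jacquetLinearMap`: `r_Q` is exact — injective on `N₁ ↪ I₂`, surjective on `N₁ ↠ N₁⁄N₂`,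
  an isomorphism on `N₁⁄N₂ ≅ ρ_η`; ★ E1a monotonicity).
* §3 **THE EXPONENT `χ_η` IS LINKED**: `χ_η = x ⊠ y` forces `y = x ν` (evaluate at `diag(t,1)` and `diag(1,t)`: `δ_Q^{1∕2} = ‖t‖^{1∕2}` resp. `‖t‖^{-1∕2}` by ★
  `rootDeltaChar_standardParabolicGL_lastBlockLabel_rpow`, so `x(t) = η(t)‖t‖^{-1∕2}`, `y(t) = η(t)‖t‖^{1∕2} = x(t)‖t‖`).
* §4 **MAIN**: if `I₂ x y` were reducible, ★ G2 (`exists_isConstituentOf_ofChar_det_of_not_isIrreducible`, with `ψ` from ★ PSI-EX) gives a constituent `⟦η ∘ det⟧`; by §2 and ★ G1 (a)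
  (`mult₂ (I₂ x y) χ = [χ = x ⊠ y] + [χ = y ⊠ x]`) `χ_η ∈ {x ⊠ y, y ⊠ x}`, so by §3 `y = x ν` or `x = y ν` — excluded.  Corollary: `x × x` is irreducible for every continuous `x`
  (`x ≠ x ν` as `ν(ϖ) = ‖ϖ‖ ≠ 1`).  (The tree's ★ `Zelevinsky1980.parabolicIndGL_two_detChar_self_isIrreducible` needs `x` UNITARY; here `x, y` are arbitrary continuous.)
HONEST LABEL: HC_CM is proved only modulo the 7 printed citations (2 remaining named inputs: hLiu418 = stmt-HodgeConjecture-24832, h413 = stmt-HodgeConjecture-24833)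
until rung 0 closes; count-neutral helper (representation theory of `GL₂(F)`; no printed citation is discharged).

## Mathlib ∕ tree search
Tree ★: G1 `K2E3GL2JacquetExponents` (`exists_jacquetLinearMap`, `finrank_weightSpace_le_of_injective`, `finrank_weightSpace_parabolicIndGL`, `commute_normalizedJacquetGL`, `maxParabolicLeviChar_two_eq_iff`,
`parabolicIndGL_two_eq_smoothIndRep`, `finiteDimensional_jacquet_parabolicIndGL`) · G2 `exists_isConstituentOf_ofChar_det_of_not_isIrreducible` · PSI-EX `exists_addChar_isContinuousNontrivial` ·
E1a `finrank_weightSpace_le_of_surjective`∕`_eq_of_linearEquiv` · E1b `weightSpace_eq_top_of_forall_apply_eq_smul`∕`…_eq_bot_…_of_ne` · `IrrClass.mk_eq_mk_iff`, `SmoothIrrep.ofChar_ρ`, `isSmooth_trivial_twist`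
(IrreducibleClasses ∕ SmoothCharacterOfCharacter) · `Subrepresentation.quotientRep`∕`mkQ`∕`mkQ_surjective`, `IsSmooth.quotientRep`, `IsSmooth.toRepresentation` · `rootDeltaChar_standardParabolicGL_lastBlockLabel_rpow`,
`rootDeltaChar_eq_one_of_mem_unipotentRadicalP` · Zelevinsky1980 `det_leviProjection_diagGL`, `diagGL_mem_standardParabolicGL`, `coe_det_leviProjection_lastBlockLabel_two_false∕_true`, `maxParabolicLeviChar_apply`,
`lastBlockLabel_apply` · `unramifiedTwist_apply`, `normAbs_lt_one_iff`, `exists_valuation_pos_lt_one` · `Liu2021.SplitPlace.isOpen_ker_of_continuous`.  Mathlib: `Representation.Coinvariants.*`,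
`Representation.Equiv.symm∕trans`, `Real.rpow_*`, `Complex.cpow_one`, `Matrix.det_fin_two`.
Dedup: `rg "UnlinkedIrreducible|of_not_linked|twist_det_two"` over `Literature Summits` — none; the unitary special cases are ★ `Zelevinsky1980.*` (different hypotheses).

## References
* [JacquetLanglands1970] H. Jacquet, R. P. Langlands, *Automorphic Forms on GL(2)*, LNM 114 (1970), Thm. 3.3.
* [BernsteinZelevinsky1977] I. N. Bernstein, A. V. Zelevinsky, *Induced representations of reductive p-adic groups I*, Ann. Sci. ÉNS 10 (1977), 2.12, Thm. 5.2.
* [Zelevinsky1980] A. V. Zelevinsky, *Induced representations of reductive p-adic groups II*, Ann. Sci. ÉNS 13 (1980), §1.1, Ex. 3.2, Thm. 4.2.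
* [Bump1997] D. Bump, *Automorphic Forms and Representations* (1997), Thm. 4.5.1–4.5.4.  * [BushnellHenniart2006] C. Bushnell, G. Henniart, *The Local Langlands Conjecture for GL(2)* (2006), §9.6, §9.11.
-/

set_option autoImplicit false
-- the mandated namespace repeats the single-problem summit's segment (`HodgeConjecture.HodgeConjecture`)
set_option linter.dupNamespace false

noncomputable section

open Module Module.End Function Matrix
open scoped MatrixGroups NNReal
open Literature.NumberTheory.Automorphic Literature.NumberTheory.Automorphic.Zelevinsky1980 ValuativeRel
open Literature.NumberTheory.GaloisRepresentations Literature.NumberTheory.GaloisRepresentations.IsNonarchimedeanLocalField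
open Literature.LinearAlgebra.Matrix.DiagonalTorus
open Summit.HodgeConjecture.HodgeConjecture.Cruxes.H413.K2E3GL2JacquetModuleStructure
open Summit.HodgeConjecture.HodgeConjecture.Cruxes.H413.K2E3GL2JacquetExponents
open Summit.HodgeConjecture.HodgeConjecture.Cruxes.H413.K2E3GL2ReducibleInducedDetCharConstituent
open Summit.HodgeConjecture.HodgeConjecture.Cruxes.H413.K2E3JacquetExponentMultiset
open Summit.HodgeConjecture.HodgeConjecture.Cruxes.H413.K2E3JacquetExponentEigenvector

namespace Summit.HodgeConjecture.HodgeConjecture.Cruxes.H413.K2E3GL2UnlinkedIrreducible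

variable {F : Type} [Field F] [ValuativeRel F] [TopologicalSpace F] [IsNonarchimedeanLocalField F]

/-! ## §1 The one-dimensional representation `ρ_η = η ∘ det` of `GL₂(F)` and its normalised Jacquet exponent `χ_η` -/

section OneDim

variable (η : Fˣ →* ℂˣ)

omit [ValuativeRel F] [TopologicalSpace F] [IsNonarchimedeanLocalField F] in
/-- `ρ_η(g) z = η(det g) · z`. [cite: Bump1997, §4.5] -/
theorem twist_det_two_apply (g : GL (Fin 2) F) (z : ℂ) :
    ((Representation.trivial ℂ (GL (Fin 2) F) ℂ).twist (η.comp (Matrix.GeneralLinearGroup.det : GL (Fin 2) F →* Fˣ))) g z = ((η (Matrix.GeneralLinearGroup.det g) : ℂˣ) : ℂ) * z := by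
  rw [Representation.twist_apply, Representation.trivial_apply, MonoidHom.comp_apply, smul_eq_mul]

omit [ValuativeRel F] [TopologicalSpace F] [IsNonarchimedeanLocalField F] in
/-- `det b = b₀₀ · b₁₁ = det(proj b)_false · det(proj b)_true` for `b` in the Borel `Q_{1,1}` of `GL₂(F)`. [cite: Zelevinsky1980, §1.1, p. 170] -/
theorem det_coe_eq_mul_det_leviProjection (b : ↥(standardParabolicGL F (lastBlockLabel 2))) :
    Matrix.GeneralLinearGroup.det (b : GL (Fin 2) F) =
      Matrix.GeneralLinearGroup.det (leviProjection F (lastBlockLabel 2) b false) * Matrix.GeneralLinearGroup.det (leviProjection F (lastBlockLabel 2) b true) := by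
  have h10 : ((b : GL (Fin 2) F) : Matrix (Fin 2) (Fin 2) F) 1 0 = 0 := by
    have hb := b.2
    rw [mem_standardParabolicGL_iff] at hb
    exact hb (show lastBlockLabel 2 (0 : Fin 2) < lastBlockLabel 2 (1 : Fin 2) by decide)
  apply Units.ext
  rw [Matrix.GeneralLinearGroup.val_det_apply, Matrix.det_fin_two, h10, mul_zero, sub_zero, Units.val_mul,
    coe_det_leviProjection_lastBlockLabel_two_false, coe_det_leviProjection_lastBlockLabel_two_true]

omit [ValuativeRel F] [TopologicalSpace F] [IsNonarchimedeanLocalField F] in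
/-- `η(det u) = 1` on the unipotent radical `U_Q` (`proj u = 1`). [cite: BernsteinZelevinsky1977, §2.3] -/
theorem eta_det_eq_one_of_mem_unipotentRadicalP_two {u : ↥(standardParabolicGL F (lastBlockLabel 2))} (hu : u ∈ unipotentRadicalP F (lastBlockLabel 2)) :
    η (Matrix.GeneralLinearGroup.det (u : GL (Fin 2) F)) = 1 := by
  rw [det_coe_eq_mul_det_leviProjection, (MonoidHom.mem_ker).1 hu, Pi.one_apply, Pi.one_apply]
  simp only [map_one, mul_one]

omit [ValuativeRel F] [TopologicalSpace F] [IsNonarchimedeanLocalField F] in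
/-- **`U_Q` acts trivially on `ρ_η`**. [cite: BernsteinZelevinsky1977, §2.3] -/
theorem restrictUnipotentGL_twist_det_two_apply (u : ↥(unipotentRadicalP F (lastBlockLabel 2))) (z : ℂ) :
    Representation.restrictUnipotentGL F (lastBlockLabel 2) ((Representation.trivial ℂ (GL (Fin 2) F) ℂ).twist (η.comp (Matrix.GeneralLinearGroup.det : GL (Fin 2) F →* Fˣ))) u z = z := by
  show ((Representation.trivial ℂ (GL (Fin 2) F) ℂ).twist (η.comp (Matrix.GeneralLinearGroup.det : GL (Fin 2) F →* Fˣ))) (((u : ↥(standardParabolicGL F (lastBlockLabel 2)))) : GL (Fin 2) F) z = z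
  rw [twist_det_two_apply, eta_det_eq_one_of_mem_unipotentRadicalP_two η u.2, Units.val_one, one_mul]

omit [ValuativeRel F] [TopologicalSpace F] [IsNonarchimedeanLocalField F] in
/-- The coinvariant kernel of `ρ_η|_{U_Q}` vanishes. [cite: BernsteinZelevinsky1977, §2.3] -/
theorem coinvariantsKer_twist_det_two_eq_bot :
    Representation.Coinvariants.ker (Representation.restrictUnipotentGL F (lastBlockLabel 2) ((Representation.trivial ℂ (GL (Fin 2) F) ℂ).twist (η.comp (Matrix.GeneralLinearGroup.det : GL (Fin 2) F →* Fˣ)))) = ⊥ := by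
  rw [Representation.Coinvariants.ker, Submodule.span_eq_bot]
  rintro _ ⟨⟨u, z⟩, rfl⟩
  exact sub_eq_zero.2 (restrictUnipotentGL_twist_det_two_apply η u z)

omit [ValuativeRel F] [TopologicalSpace F] [IsNonarchimedeanLocalField F] in
/-- **`r_Q ρ_η` is a line**: finite-dimensional of dimension `1`. [cite: BernsteinZelevinsky1977, §2.3, 2.12] -/
theorem finrank_coinvariants_twist_det_two :
    FiniteDimensional ℂ (Representation.restrictUnipotentGL F (lastBlockLabel 2) ((Representation.trivial ℂ (GL (Fin 2) F) ℂ).twist (η.comp (Matrix.GeneralLinearGroup.det : GL (Fin 2) F →* Fˣ)))).Coinvariants ∧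
      finrank ℂ (Representation.restrictUnipotentGL F (lastBlockLabel 2) ((Representation.trivial ℂ (GL (Fin 2) F) ℂ).twist (η.comp (Matrix.GeneralLinearGroup.det : GL (Fin 2) F →* Fˣ)))).Coinvariants = 1 := by
  refine ⟨inferInstance, ?_⟩
  have e : (Representation.restrictUnipotentGL F (lastBlockLabel 2) ((Representation.trivial ℂ (GL (Fin 2) F) ℂ).twist (η.comp (Matrix.GeneralLinearGroup.det : GL (Fin 2) F →* Fˣ)))).Coinvariants ≃ₗ[ℂ] ℂ :=
    Submodule.quotEquivOfEqBot _ (coinvariantsKer_twist_det_two_eq_bot η)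
  rw [e.finrank_eq, Module.finrank_self]

/-- **THE NORMALISED JACQUET ACTION ON `r_Q ρ_η = ℂ` IS THE CHARACTER `χ_η = (η ⊠ η) · (δ_Q^{1∕2} ∘ diag)⁻¹`** (★ `normalizedJacquetGL_mk`; `det (diag m) = det m_false · det m_true`).
[cite: BernsteinZelevinsky1977, §2.3, 2.12] [cite: Zelevinsky1980, Ex. 3.2] -/
theorem normalizedJacquetGL_twist_det_two_mk (m : (Π a : Bool, GL {i : Fin 2 // lastBlockLabel 2 i = a} F)) (z : ℂ) :
    Representation.normalizedJacquetGL F (lastBlockLabel 2) ((Representation.trivial ℂ (GL (Fin 2) F) ℂ).twist (η.comp (Matrix.GeneralLinearGroup.det : GL (Fin 2) F →* Fˣ))) m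
        (Representation.Coinvariants.mk (Representation.restrictUnipotentGL F (lastBlockLabel 2) ((Representation.trivial ℂ (GL (Fin 2) F) ℂ).twist (η.comp (Matrix.GeneralLinearGroup.det : GL (Fin 2) F →* Fˣ)))) z) =
      (((maxParabolicLeviChar F 2 η η * ((rootDeltaChar (standardParabolicGL F (lastBlockLabel 2))).comp (leviEmbeddingP F (lastBlockLabel 2)))⁻¹) m : ℂˣ) : ℂ) • Representation.Coinvariants.mk (Representation.restrictUnipotentGL F (lastBlockLabel 2) ((Representation.trivial ℂ (GL (Fin 2) F) ℂ).twist (η.comp (Matrix.GeneralLinearGroup.det : GL (Fin 2) F →* Fˣ)))) z := by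
  rw [Representation.normalizedJacquetGL_mk, twist_det_two_apply, ← smul_eq_mul, map_smul, smul_smul, ← Units.val_mul]
  congr 2
  rw [MonoidHom.mul_apply, MonoidHom.inv_apply, MonoidHom.comp_apply, maxParabolicLeviChar_apply, ← coe_leviEmbeddingP,
    det_coe_eq_mul_det_leviProjection, leviProjection_leviEmbeddingP_apply, map_mul, mul_comm]

/-- **`mult₂ ρ_η χ = [χ = χ_η]`**: the normalised Jacquet module of `ρ_η = η ∘ det` has the single exponent `χ_η`, with multiplicity one (★ E1b one-dimensional weight spaces).
[cite: BernsteinZelevinsky1977, 2.12] [cite: Zelevinsky1980, §1.1, Ex. 3.2] -/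
theorem finrank_weightSpace_twist_det_two (χ : (Π a : Bool, GL {i : Fin 2 // lastBlockLabel 2 i = a} F) →* ℂˣ) [Decidable (χ = (maxParabolicLeviChar F 2 η η * ((rootDeltaChar (standardParabolicGL F (lastBlockLabel 2))).comp (leviEmbeddingP F (lastBlockLabel 2)))⁻¹))] :
    finrank ℂ ↥(⨅ m, Module.End.maxGenEigenspace (Representation.normalizedJacquetGL F (lastBlockLabel 2) ((Representation.trivial ℂ (GL (Fin 2) F) ℂ).twist (η.comp (Matrix.GeneralLinearGroup.det : GL (Fin 2) F →* Fˣ))) m) ((χ m : ℂˣ) : ℂ)) = if χ = (maxParabolicLeviChar F 2 η η * ((rootDeltaChar (standardParabolicGL F (lastBlockLabel 2))).comp (leviEmbeddingP F (lastBlockLabel 2)))⁻¹) then 1 else 0 := by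
  haveI := (finrank_coinvariants_twist_det_two η).1
  have hτ : ∀ (m : (Π a : Bool, GL {i : Fin 2 // lastBlockLabel 2 i = a} F)) (v : (Representation.restrictUnipotentGL F (lastBlockLabel 2) ((Representation.trivial ℂ (GL (Fin 2) F) ℂ).twist (η.comp (Matrix.GeneralLinearGroup.det : GL (Fin 2) F →* Fˣ)))).Coinvariants),
      Representation.normalizedJacquetGL F (lastBlockLabel 2) ((Representation.trivial ℂ (GL (Fin 2) F) ℂ).twist (η.comp (Matrix.GeneralLinearGroup.det : GL (Fin 2) F →* Fˣ))) m v = (fun m => (((maxParabolicLeviChar F 2 η η * ((rootDeltaChar (standardParabolicGL F (lastBlockLabel 2))).comp (leviEmbeddingP F (lastBlockLabel 2)))⁻¹) m : ℂˣ) : ℂ)) m • v := by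
    intro m v
    obtain ⟨z, rfl⟩ := Representation.Coinvariants.mk_surjective _ v
    exact normalizedJacquetGL_twist_det_two_mk η m z
  split_ifs with h
  · subst h
    rw [weightSpace_eq_top_of_forall_apply_eq_smul _ _ hτ, finrank_top, (finrank_coinvariants_twist_det_two η).2]
  · have hne : (fun m => ((χ m : ℂˣ) : ℂ)) ≠ fun m => (((maxParabolicLeviChar F 2 η η * ((rootDeltaChar (standardParabolicGL F (lastBlockLabel 2))).comp (leviEmbeddingP F (lastBlockLabel 2)))⁻¹) m : ℂˣ) : ℂ) := fun hfun =>
      h (MonoidHom.ext fun m => Units.val_injective (congrFun hfun m))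
    rw [weightSpace_eq_bot_of_forall_apply_eq_smul_of_ne _ _ hτ hne, finrank_bot]

end OneDim

/-! ## §2 A constituent's exponent occurs in the Jacquet module -/

section Constituent

/-- **A CONSTITUENT `⟦η ∘ det⟧` OF A SMOOTH `π` (with `r_Q π` finite-dimensional) MAKES THE EXPONENT `χ_η` OCCUR IN `r_Q π`**: unfolding ★ `IrrClass.IsConstituentOf`
(`N₂ ≤ N₁ ≤ π` with `N₁ ⁄ N₂ ≅ η ∘ det`), exactness of `r_Q` (★ G1 `exists_jacquetLinearMap`: injective along `N₁ ↪ π`, surjective along `N₁ ↠ N₁ ⁄ N₂`, an isomorphism along `N₁ ⁄ N₂ ≅ ρ_η`)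
and ★ E1a monotonicity give `mult₂ π χ_η ≥ mult₂ N₁ χ_η ≥ mult₂ (N₁⁄N₂) χ_η = mult₂ ρ_η χ_η = 1` (§1).  Stated for an ABSTRACT `π` (instantiate `π := x × y`).
[cite: BernsteinZelevinsky1977, Prop. 1.9 (a), 2.12] [cite: Zelevinsky1980, Ex. 3.2] -/
theorem one_le_finrank_weightSpace_of_isConstituentOf_ofChar {V : Type} [AddCommGroup V] [Module ℂ V] (π : Representation ℂ (GL (Fin 2) F) V) (hπ : π.IsSmooth)
    [FiniteDimensional ℂ (Representation.restrictUnipotentGL F (lastBlockLabel 2) π).Coinvariants]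
    (η : Fˣ →* ℂˣ) (hη : IsOpen (((η.comp (Matrix.GeneralLinearGroup.det : GL (Fin 2) F →* Fˣ)).ker : Subgroup (GL (Fin 2) F)) : Set (GL (Fin 2) F)))
    (hc : (IrrClass.mk (SmoothIrrep.ofChar (η.comp (Matrix.GeneralLinearGroup.det : GL (Fin 2) F →* Fˣ)) hη)).IsConstituentOf π) :
    1 ≤ finrank ℂ ↥(⨅ m, Module.End.maxGenEigenspace (Representation.normalizedJacquetGL F (lastBlockLabel 2) π m) (((maxParabolicLeviChar F 2 η η * ((rootDeltaChar (standardParabolicGL F (lastBlockLabel 2))).comp (leviEmbeddingP F (lastBlockLabel 2)))⁻¹) m : ℂˣ) : ℂ)) := by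
  classical
  obtain ⟨r, hr, N₁, N₂, hle, ⟨e⟩⟩ := hc
  obtain ⟨e₀⟩ := (IrrClass.mk_eq_mk_iff _ _).1 hr
  have hN₁s : N₁.toRepresentation.IsSmooth := hπ.toRepresentation N₁
  -- the subquotient `N₁ ⁄ N₂` as the quotient of `N₁` by the pulled-back subrepresentation `N₂'`
  let N₂' : Subrepresentation N₁.toRepresentation :=
    ⟨N₂.toSubmodule.comap N₁.toSubmodule.subtype, fun g _ hv => N₂.apply_mem_toSubmodule g hv⟩
  have hQs : N₂'.quotientRep.IsSmooth := hN₁s.quotientRep N₂'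
  -- (i) `r_Q N₁ ↪ r_Q π`
  let ι : N₁.toRepresentation.IntertwiningMap π := ⟨N₁.toSubmodule.subtype, fun g => LinearMap.ext fun _ => rfl⟩
  have hιinj : Function.Injective ι := fun a b hab => Subtype.ext hab
  obtain ⟨j₁, -, hj₁, hj₁inj, -⟩ := exists_jacquetLinearMap (V₁ := ↥N₁.toSubmodule) (V₂ := V) N₁.toRepresentation π hπ ι
  haveI : FiniteDimensional ℂ (Representation.restrictUnipotentGL F (lastBlockLabel 2) N₁.toRepresentation).Coinvariants :=
    Module.Finite.of_injective j₁ (hj₁inj hιinj)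
  have h₁ := K2E3JacquetExponentMultiset.finrank_weightSpace_le_of_injective
    (W₁ := (Representation.restrictUnipotentGL F (lastBlockLabel 2) N₁.toRepresentation).Coinvariants)
    (W₂ := (Representation.restrictUnipotentGL F (lastBlockLabel 2) π).Coinvariants)
    (Representation.normalizedJacquetGL F (lastBlockLabel 2) N₁.toRepresentation) (Representation.normalizedJacquetGL F (lastBlockLabel 2) π)
    j₁ hj₁ (hj₁inj hιinj) (fun m => (((maxParabolicLeviChar F 2 η η * ((rootDeltaChar (standardParabolicGL F (lastBlockLabel 2))).comp (leviEmbeddingP F (lastBlockLabel 2)))⁻¹) m : ℂˣ) : ℂ))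
  -- (ii) `r_Q N₁ ↠ r_Q (N₁ ⁄ N₂)`
  obtain ⟨j₂, -, hj₂, -, hj₂surj⟩ := exists_jacquetLinearMap (V₁ := ↥N₁.toSubmodule) (V₂ := ↥N₁.toSubmodule ⧸ N₂'.toSubmodule)
    N₁.toRepresentation N₂'.quotientRep hQs N₂'.mkQ
  have h₂ := finrank_weightSpace_le_of_surjective
    (W₁ := (Representation.restrictUnipotentGL F (lastBlockLabel 2) N₁.toRepresentation).Coinvariants)
    (W₂ := (Representation.restrictUnipotentGL F (lastBlockLabel 2) N₂'.quotientRep).Coinvariants)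
    (Representation.normalizedJacquetGL F (lastBlockLabel 2) N₁.toRepresentation) (Representation.normalizedJacquetGL F (lastBlockLabel 2) N₂'.quotientRep)
    (commute_normalizedJacquetGL (X := ↥N₁.toSubmodule) N₁.toRepresentation) (commute_normalizedJacquetGL (X := ↥N₁.toSubmodule ⧸ N₂'.toSubmodule) N₂'.quotientRep)
    j₂ hj₂ (hj₂surj N₂'.mkQ_surjective) (fun m => (((maxParabolicLeviChar F 2 η η * ((rootDeltaChar (standardParabolicGL F (lastBlockLabel 2))).comp (leviEmbeddingP F (lastBlockLabel 2)))⁻¹) m : ℂˣ) : ℂ))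
  -- (iii) `r_Q (N₁ ⁄ N₂) ≅ r_Q r ≅ r_Q ρ_η`, and `mult₂ ρ_η χ_η = 1`
  obtain ⟨j₃, -, hj₃, hj₃inj, hj₃surj⟩ := exists_jacquetLinearMap (V₁ := ↥N₁.toSubmodule ⧸ N₂'.toSubmodule) (V₂ := r.V)
    N₂'.quotientRep r.ρ r.isSmooth e.symm.toIntertwiningMap
  have h₃ := finrank_weightSpace_eq_of_linearEquiv
    (W₁ := (Representation.restrictUnipotentGL F (lastBlockLabel 2) N₂'.quotientRep).Coinvariants)
    (W₂ := (Representation.restrictUnipotentGL F (lastBlockLabel 2) r.ρ).Coinvariants)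
    (Representation.normalizedJacquetGL F (lastBlockLabel 2) N₂'.quotientRep) (Representation.normalizedJacquetGL F (lastBlockLabel 2) r.ρ)
    (LinearEquiv.ofBijective j₃ ⟨hj₃inj e.symm.injective, hj₃surj e.symm.surjective⟩) (fun m v => hj₃ m v) (fun m => (((maxParabolicLeviChar F 2 η η * ((rootDeltaChar (standardParabolicGL F (lastBlockLabel 2))).comp (leviEmbeddingP F (lastBlockLabel 2)))⁻¹) m : ℂˣ) : ℂ))
  have hχs : Representation.IsSmooth ((Representation.trivial ℂ (GL (Fin 2) F) ℂ).twist (η.comp (Matrix.GeneralLinearGroup.det : GL (Fin 2) F →* Fˣ))) := isSmooth_trivial_twist hη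
  obtain ⟨j₄, -, hj₄, hj₄inj, hj₄surj⟩ := exists_jacquetLinearMap (V₁ := r.V) (V₂ := ℂ) r.ρ ((Representation.trivial ℂ (GL (Fin 2) F) ℂ).twist (η.comp (Matrix.GeneralLinearGroup.det : GL (Fin 2) F →* Fˣ))) hχs e₀.toIntertwiningMap
  have h₄ := finrank_weightSpace_eq_of_linearEquiv
    (W₁ := (Representation.restrictUnipotentGL F (lastBlockLabel 2) r.ρ).Coinvariants)
    (W₂ := (Representation.restrictUnipotentGL F (lastBlockLabel 2) ((Representation.trivial ℂ (GL (Fin 2) F) ℂ).twist (η.comp (Matrix.GeneralLinearGroup.det : GL (Fin 2) F →* Fˣ)))).Coinvariants)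
    (Representation.normalizedJacquetGL F (lastBlockLabel 2) r.ρ) (Representation.normalizedJacquetGL F (lastBlockLabel 2) ((Representation.trivial ℂ (GL (Fin 2) F) ℂ).twist (η.comp (Matrix.GeneralLinearGroup.det : GL (Fin 2) F →* Fˣ))))
    (LinearEquiv.ofBijective j₄ ⟨hj₄inj e₀.injective, hj₄surj e₀.surjective⟩) (fun m v => hj₄ m v) (fun m => (((maxParabolicLeviChar F 2 η η * ((rootDeltaChar (standardParabolicGL F (lastBlockLabel 2))).comp (leviEmbeddingP F (lastBlockLabel 2)))⁻¹) m : ℂˣ) : ℂ))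
  have h₅ : finrank ℂ ↥(⨅ m, Module.End.maxGenEigenspace (Representation.normalizedJacquetGL F (lastBlockLabel 2) ((Representation.trivial ℂ (GL (Fin 2) F) ℂ).twist (η.comp (Matrix.GeneralLinearGroup.det : GL (Fin 2) F →* Fˣ))) m) (((maxParabolicLeviChar F 2 η η * ((rootDeltaChar (standardParabolicGL F (lastBlockLabel 2))).comp (leviEmbeddingP F (lastBlockLabel 2)))⁻¹) m : ℂˣ) : ℂ)) = 1 := by
    rw [finrank_weightSpace_twist_det_two η (maxParabolicLeviChar F 2 η η * ((rootDeltaChar (standardParabolicGL F (lastBlockLabel 2))).comp (leviEmbeddingP F (lastBlockLabel 2)))⁻¹), if_pos rfl]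
  have h := h₂.trans h₁
  rw [h₃, h₄, h₅] at h
  exact h

end Constituent

/-! ## §3 The exponent `χ_η` is linked: `χ_η = x ⊠ y ⇒ y = x ν` -/

section Linked

variable (η : Fˣ →* ℂˣ)

omit [ValuativeRel F] [TopologicalSpace F] [IsNonarchimedeanLocalField F] in
/-- The Levi blocks of `diag(d₀, d₁) ∈ Q_{1,1}`: `det = d₀` on the block `false` and `= d₁` on the block `true`. [cite: Zelevinsky1980, §1.1, p. 170] -/
theorem det_leviProjection_diagGL_two (d : Fin 2 → Fˣ) :
    Matrix.GeneralLinearGroup.det (leviProjection F (lastBlockLabel 2) ⟨diagGL (Fin 2) d, diagGL_mem_standardParabolicGL _ _⟩ false) = d 0 ∧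
      Matrix.GeneralLinearGroup.det (leviProjection F (lastBlockLabel 2) ⟨diagGL (Fin 2) d, diagGL_mem_standardParabolicGL _ _⟩ true) = d 1 := by
  constructor <;> apply Units.ext
  · rw [coe_det_leviProjection_lastBlockLabel_two_false]
    change ((diagGL (Fin 2) d : GL (Fin 2) F) : Matrix (Fin 2) (Fin 2) F) 0 0 = _
    rw [val_diagGL, diagonal_apply_eq]
  · rw [coe_det_leviProjection_lastBlockLabel_two_true]
    change ((diagGL (Fin 2) d : GL (Fin 2) F) : Matrix (Fin 2) (Fin 2) F) 1 1 = _
    rw [val_diagGL, diagonal_apply_eq]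

omit [ValuativeRel F] [TopologicalSpace F] [IsNonarchimedeanLocalField F] in
/-- `(x ⊠ y)(diag(d₀, d₁)) = x(d₀) y(d₁)`. [cite: Zelevinsky1980, §3.2, p. 181] -/
theorem maxParabolicLeviChar_leviProjection_diagGL_two (x y : Fˣ →* ℂˣ) (d : Fin 2 → Fˣ) :
    maxParabolicLeviChar F 2 x y (leviProjection F (lastBlockLabel 2) ⟨diagGL (Fin 2) d, diagGL_mem_standardParabolicGL _ _⟩) = x (d 0) * y (d 1) := by
  rw [maxParabolicLeviChar_apply, (det_leviProjection_diagGL_two d).1, (det_leviProjection_diagGL_two d).2]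

/-- **`δ_Q^{1∕2}` at `diag(d₀, d₁)`** (block-diagonal part of itself): `‖d₀‖^{1∕2} · ‖d₁‖^{-1∕2}` (★ `rootDeltaChar_standardParabolicGL_lastBlockLabel_rpow` at `N = 2`).
[cite: BernsteinZelevinsky1977, 1.7] [cite: Bump1997, §4.2 (2.2)–(2.3)] -/
theorem coe_rootDeltaChar_leviEmbeddingP_diagGL_two (d : Fin 2 → Fˣ) :
    ((rootDeltaChar (standardParabolicGL F (lastBlockLabel 2)) (leviEmbeddingP F (lastBlockLabel 2) (leviProjection F (lastBlockLabel 2) ⟨diagGL (Fin 2) d, diagGL_mem_standardParabolicGL _ _⟩)) : ℂˣ) : ℂ) =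
      ((((normAbs F (d 0 : F) : ℝ≥0) : ℝ) ^ ((1 : ℝ) / 2) * ((normAbs F (d 1 : F) : ℝ≥0) : ℝ) ^ ((1 - ((2 : ℕ) : ℝ)) / 2) : ℝ) : ℂ) := by
  rw [rootDeltaChar_standardParabolicGL_lastBlockLabel_rpow F (by norm_num : 1 ≤ 2), leviProjection_leviEmbeddingP_apply,
    (det_leviProjection_diagGL_two d).1, (det_leviProjection_diagGL_two d).2]

/-- **`χ_η` at `diag(d₀, d₁)`**: `η(d₀) η(d₁) · (‖d₀‖^{1∕2} ‖d₁‖^{-1∕2})⁻¹`. [cite: Zelevinsky1980, Ex. 3.2] [cite: Bump1997, §4.5] -/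
theorem coe_chi_leviProjection_diagGL_two (d : Fin 2 → Fˣ) :
    (((maxParabolicLeviChar F 2 η η * ((rootDeltaChar (standardParabolicGL F (lastBlockLabel 2))).comp (leviEmbeddingP F (lastBlockLabel 2)))⁻¹) (leviProjection F (lastBlockLabel 2) ⟨diagGL (Fin 2) d, diagGL_mem_standardParabolicGL _ _⟩) : ℂˣ) : ℂ) =
      ((η (d 0) : ℂˣ) : ℂ) * ((η (d 1) : ℂˣ) : ℂ) *
        (((((normAbs F (d 0 : F) : ℝ≥0) : ℝ) ^ ((1 : ℝ) / 2) * ((normAbs F (d 1 : F) : ℝ≥0) : ℝ) ^ ((1 - ((2 : ℕ) : ℝ)) / 2) : ℝ) : ℂ))⁻¹ := by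
  rw [MonoidHom.mul_apply, MonoidHom.inv_apply, MonoidHom.comp_apply, Units.val_mul, Units.val_inv_eq_inv_val, maxParabolicLeviChar_leviProjection_diagGL_two,
    Units.val_mul, coe_rootDeltaChar_leviEmbeddingP_diagGL_two]

/-- The real identity behind the linking: for `r > 0`, `(1^{1∕2} · r^{(1-2)∕2})⁻¹ = (r^{1∕2} · 1^{(1-2)∕2})⁻¹ · r` (both are `r^{1∕2}`). [cite: Bump1997, Thm. 4.5.1] -/
theorem inv_one_rpow_mul_rpow_eq {r : ℝ} (hr : 0 < r) :
    ((1 : ℝ) ^ ((1 : ℝ) / 2) * r ^ ((1 - ((2 : ℕ) : ℝ)) / 2))⁻¹ = (r ^ ((1 : ℝ) / 2) * (1 : ℝ) ^ ((1 - ((2 : ℕ) : ℝ)) / 2))⁻¹ * r := by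
  have hexp : ((1 - ((2 : ℕ) : ℝ)) / 2 : ℝ) = -((1 : ℝ) / 2) := by norm_num
  rw [hexp, Real.one_rpow, Real.one_rpow, one_mul, mul_one, Real.rpow_neg hr.le, inv_inv]
  have hs : 0 < r ^ ((1 : ℝ) / 2) := Real.rpow_pos_of_pos hr _
  have hsq : r ^ ((1 : ℝ) / 2) * r ^ ((1 : ℝ) / 2) = r := by
    rw [← Real.rpow_add hr]; norm_num
  field_simp
  linarith [hsq]

/-- `ν(t) = ‖t‖` in `ℂ`. [cite: Zelevinsky1980, §1.1] -/
theorem coe_unramifiedTwist_one (t : Fˣ) : ((((((unramifiedTwist F 1 : QuasiChar F).toMonoidHom) t) : ℂˣ)) : ℂ) = (((normAbs F (t : F) : ℝ≥0) : ℝ) : ℂ) := by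
  change ((unramifiedTwist F 1 t : ℂˣ) : ℂ) = _
  rw [unramifiedTwist_apply, Complex.cpow_one]

/-- **THE EXPONENT `χ_η` IS LINKED**: if `χ_η = x ⊠ y` then `y = x · ν` — evaluate at `diag(t, 1)` (`x t = η t ‖t‖^{-1∕2}`) and `diag(1, t)` (`y t = η t ‖t‖^{1∕2}`).
[cite: JacquetLanglands1970, Thm. 3.3] [cite: Bump1997, Thm. 4.5.1] [cite: BushnellHenniart2006, §9.11] -/
theorem eq_mul_unramifiedTwist_of_chi_eq (x y : Fˣ →* ℂˣ) (h : (maxParabolicLeviChar F 2 η η * ((rootDeltaChar (standardParabolicGL F (lastBlockLabel 2))).comp (leviEmbeddingP F (lastBlockLabel 2)))⁻¹) = maxParabolicLeviChar F 2 x y) : y = x * ((unramifiedTwist F 1 : QuasiChar F).toMonoidHom) := by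
  ext t
  have hf := congrArg (fun χ : (Π a : Bool, GL {i : Fin 2 // lastBlockLabel 2 i = a} F) →* ℂˣ => ((χ (leviProjection F (lastBlockLabel 2) ⟨diagGL (Fin 2) ![t, 1], diagGL_mem_standardParabolicGL _ _⟩) : ℂˣ) : ℂ)) h
  have ht := congrArg (fun χ : (Π a : Bool, GL {i : Fin 2 // lastBlockLabel 2 i = a} F) →* ℂˣ => ((χ (leviProjection F (lastBlockLabel 2) ⟨diagGL (Fin 2) ![1, t], diagGL_mem_standardParabolicGL _ _⟩) : ℂˣ) : ℂ)) h
  simp only [coe_chi_leviProjection_diagGL_two, maxParabolicLeviChar_leviProjection_diagGL_two, Matrix.cons_val_zero, Matrix.cons_val_one,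
    map_one, Units.val_one, one_mul, mul_one, NNReal.coe_one] at hf ht
  have hr : 0 < ((normAbs F (t : F) : ℝ≥0) : ℝ) := by exact_mod_cast (normAbs_units_ne_zero t).bot_lt
  rw [MonoidHom.mul_apply, Units.val_mul, coe_unramifiedTwist_one, ← hf, ← ht, ← Complex.ofReal_inv, ← Complex.ofReal_inv, inv_one_rpow_mul_rpow_eq hr,
    Complex.ofReal_mul, mul_assoc]

end Linked

/-! ## §4 Unlinked ⇒ irreducible -/

section Main

/-- **UNLINKED ⇒ IRREDUCIBLE**: for continuous characters `x, y` of `F^×` with `y ≠ x ν` and `x ≠ y ν` the principal series `x × y = i_{Q_{1,1}}(x ⊠ y)` of `GL₂(F)` is irreducible.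
If not, ★ G2 (with `ψ` from ★ PSI-EX) gives a constituent `⟦η ∘ det⟧`; by §2 its exponent `χ_η` occurs in `r_Q(x × y)`, whose exponents are `x ⊠ y`, `y ⊠ x` (★ G1 (a)); so
`χ_η = x ⊠ y` or `= y ⊠ x`, and §3 links `x, y`. [cite: JacquetLanglands1970, Thm. 3.3] [cite: BernsteinZelevinsky1977, Thm. 5.2] [cite: Zelevinsky1980, Thm. 4.2] [cite: Bump1997, Thm. 4.5.1–4.5.3] -/
theorem isIrreducible_parabolicIndGL_two_of_not_linked (x y : Fˣ →* ℂˣ) (hx : Continuous fun a => ((x a : ℂˣ) : ℂ)) (hy : Continuous fun a => ((y a : ℂˣ) : ℂ))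
    (hxy : y ≠ x * ((unramifiedTwist F 1 : QuasiChar F).toMonoidHom)) (hyx : x ≠ y * ((unramifiedTwist F 1 : QuasiChar F).toMonoidHom)) :
    (Representation.parabolicIndGL F (lastBlockLabel 2) ((Representation.trivial ℂ (Π a : Bool, GL {i : Fin 2 // lastBlockLabel 2 i = a} F) ℂ).twist (maxParabolicLeviChar F 2 x y))).IsIrreducible := by
  classical
  by_contra hirr
  obtain ⟨ψ, hψ⟩ := K2E3LocalFieldAddCharExists.exists_addChar_isContinuousNontrivial F
  obtain ⟨η, hη, hc⟩ := exists_isConstituentOf_ofChar_det_of_not_isIrreducible hψ x y hx hy hirr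
  have hx' := Liu2021.SplitPlace.isOpen_ker_of_continuous x hx
  have hy' := Liu2021.SplitPlace.isOpen_ker_of_continuous y hy
  have hIs : Representation.IsSmooth (Representation.parabolicIndGL F (lastBlockLabel 2) ((Representation.trivial ℂ (Π a : Bool, GL {i : Fin 2 // lastBlockLabel 2 i = a} F) ℂ).twist (maxParabolicLeviChar F 2 x y))) := by
    rw [parabolicIndGL_two_eq_smoothIndRep]; exact Representation.isSmooth_smoothInd _ _
  haveI := finiteDimensional_jacquet_parabolicIndGL x y hx' hy'
  have h1 := one_le_finrank_weightSpace_of_isConstituentOf_ofChar _ hIs η hη hc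
  rw [finrank_weightSpace_parabolicIndGL x y hx' hy' (maxParabolicLeviChar F 2 η η * ((rootDeltaChar (standardParabolicGL F (lastBlockLabel 2))).comp (leviEmbeddingP F (lastBlockLabel 2)))⁻¹)] at h1
  by_cases h₁ : (maxParabolicLeviChar F 2 η η * ((rootDeltaChar (standardParabolicGL F (lastBlockLabel 2))).comp (leviEmbeddingP F (lastBlockLabel 2)))⁻¹) = maxParabolicLeviChar F 2 x y
  · exact hxy (eq_mul_unramifiedTwist_of_chi_eq η x y h₁)
  · by_cases h₂ : (maxParabolicLeviChar F 2 η η * ((rootDeltaChar (standardParabolicGL F (lastBlockLabel 2))).comp (leviEmbeddingP F (lastBlockLabel 2)))⁻¹) = maxParabolicLeviChar F 2 y x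
    · exact hyx (eq_mul_unramifiedTwist_of_chi_eq η y x h₂)
    · rw [if_neg h₁, if_neg h₂] at h1
      exact Nat.not_succ_le_zero 0 h1

/-- **`x × x` IS IRREDUCIBLE FOR EVERY CONTINUOUS `x`** (`x` and `x` are never linked: `ν ≠ 1` because `ν(ϖ) = ‖ϖ‖ < 1` for `0 < |ϖ| < 1`).  No unitarity hypothesis (contrast ★
`Zelevinsky1980.parabolicIndGL_two_detChar_self_isIrreducible`). [cite: Bump1997, Thm. 4.5.1–4.5.3] [cite: Zelevinsky1980, Thm. 4.2, Ex. 3.2] -/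
theorem isIrreducible_parabolicIndGL_two_self (x : Fˣ →* ℂˣ) (hx : Continuous fun a => ((x a : ℂˣ) : ℂ)) :
    (Representation.parabolicIndGL F (lastBlockLabel 2) ((Representation.trivial ℂ (Π a : Bool, GL {i : Fin 2 // lastBlockLabel 2 i = a} F) ℂ).twist (maxParabolicLeviChar F 2 x x))).IsIrreducible := by
  have hν : x ≠ x * ((unramifiedTwist F 1 : QuasiChar F).toMonoidHom) := by
    intro h
    obtain ⟨ϖ, hϖ0, hϖ1⟩ := exists_valuation_pos_lt_one (F := F)
    have hu := congrArg (fun χ : Fˣ →* ℂˣ => ((χ (Units.mk0 ϖ ((Valuation.ne_zero_iff _).1 hϖ0)) : ℂˣ) : ℂ)) h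
    simp only [MonoidHom.mul_apply, Units.val_mul, coe_unramifiedTwist_one, Units.val_mk0] at hu
    have hlt : ((normAbs F ϖ : ℝ≥0) : ℝ) < 1 := by exact_mod_cast (normAbs_lt_one_iff.2 hϖ1)
    have hne : ((x (Units.mk0 ϖ ((Valuation.ne_zero_iff _).1 hϖ0)) : ℂˣ) : ℂ) ≠ 0 := Units.ne_zero _
    have h1 : (((normAbs F ϖ : ℝ≥0) : ℝ) : ℂ) = 1 := by
      have := mul_left_cancel₀ hne (hu.symm.trans (mul_one _).symm)
      exact this
    have : ((normAbs F ϖ : ℝ≥0) : ℝ) = 1 := by exact_mod_cast h1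
    exact absurd this hlt.ne
  exact isIrreducible_parabolicIndGL_two_of_not_linked x x hx hx hν hν

end Main

end Summit.HodgeConjecture.HodgeConjecture.Cruxes.H413.K2E3GL2UnlinkedIrreducible

end
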